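import Literature.NumberTheory.DiophantineGeometry.AbcWave0
import Literature.NumberTheory.DiophantineGeometry.CatalanCasselsTheorem
import Mathlib.NumberTheory.NumberField.Cyclotomic.Basic
import HarnessLib

/-!
# The double Wieferich criterion, elementary half (Schoof, Chapter 10)

[Schoof2009, Chapter 10] proves Mihăilescu's **Theorem I** (the double Wieferich criterion,
P. Mihăilescu 2000) in two steps:

* **Theorem 10.2**: for odd primes `p, q` and non-zero integers with `x ^ p - y ^ q = 1`,
  `q² ∣ x` and `p² ∣ y`. Its proof has an algebraic input — Stickelberger's theorem through
  [Schoof2009, Proposition 10.1]: for an element `θ = Σ n_σ σ` of the ideal `(1 - ι)·𝒮` of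
  `ℤ[Gal(ℚ(ζ_p)/ℚ)]` one has `(1 - ζ_p x)^θ = β^q` — and an elementary `q`-adic output:
  from such an identity with some coefficient `n_σ ≢ 0 (mod q)` and `q ∣ x` (Cassels) one gets
  `q² ∣ x` ([Schoof2009, p. 68]: `𝓞/q` is reduced as `q ≠ p` is unramified, Exercises 10.1–10.2,
  so `β^q ≡ 1 (mod q)` upgrades to `(mod q²)`; expanding, `x Σ n_σ σ(ζ_p) ≡ 0 (mod q²)`, and
  the `σ(ζ_p)` are `ℤ`-independent modulo `q`).
* **Theorem I from Theorem 10.2** ([Schoof2009, p. 67–68]): with `x - 1 = p^(q-1) a^q`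
  (Corollary 6.5) and `q² ∣ x`, `a^q ≡ -1 (mod q²)` and so `p^(q-1) ≡ 1 (mod q²)`.

This file proves the whole elementary part, for an arbitrary `p`-th cyclotomic field `K`:

* `Catalan.isReduced_quotient_span_prime` — `𝓞 K ⧸ (q)` is reduced for a prime `q ≠ p`
  ([Schoof2009, Exercise 10.2]);
* `Catalan.sq_dvd_pow_sub_one_of_dvd` — `q ∣ β^q - 1 ⇒ q² ∣ β^q - 1` in `𝓞 K`
  ([Schoof2009, Exercise 10.1]);
* `Catalan.dvd_coeff_of_dvd_sum_mul_zeta_pow` — `q ∣ Σ_{0<i<p} n_i ζ^i ⇒ q ∣ n_i`;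
* `Catalan.sq_dvd_of_prod_one_sub_zeta_pow_mul_eq_pow` — the `q`-adic kernel of Theorem 10.2:
  `q ∣ x`, `∏_{0<i<p} (1 - ζ^i x)^(n_i) = β^q`, some `q ∤ n_i` `⇒ q² ∣ x`;
* `Catalan.isWieferich_of_sq_dvd` — Theorem I from Theorem 10.2 (and Corollary 6.5);
* `Catalan.isWieferich_of_prod_one_sub_zeta_pow_mul_eq_pow` — hence Theorem I for `(p, q)` from
  the Stickelberger output alone.

What is *not* here is the algebraic input (Proposition 10.1: Stickelberger's theorem and the
obstruction group of Chapter 7); with it, `Catalan.mihailescu_of_mihailescu_theorems`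
(`CatalanAssembly`) receives its hypothesis `hI`. No named fact is introduced.

## References

* R. Schoof, *Catalan's Conjecture*, Universitext, Springer 2009 [Schoof2009], Chapter 10
  (Proposition 10.1, Theorem 10.2, Theorem I, Exercises 10.1–10.4; book pp. 67–69) — held,
  `lit read book:schoof2009-catalan-s-conjecture` (PDF pp. 148–150).
* P. Mihăilescu, *A class number free criterion for Catalan's conjecture*, J. Number Theory
  **99** (2003), 225–231.
-/

namespace Literature.NumberTheory.DiophantineGeometry

namespace Catalan

open Finset NumberField

/-! ### Two ring-theoretic expansions -/

/-- `(1 + q γ)^q ≡ 1 (mod q²)` in any commutative ring (binomial theorem). [folklore] -/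
theorem sq_dvd_one_add_mul_pow_sub_one {R : Type*} [CommRing R] (q : ℕ) (γ : R) :
    (q : R) ^ 2 ∣ (1 + q * γ) ^ q - 1 := by
  have h := sq_dvd_add_pow_sub_sub ((q : R) * γ) 1 q
  simp only [one_pow, one_mul] at h
  have e : (1 + (q : R) * γ) ^ q - 1
      = ((1 + (q : R) * γ) ^ q - (q : R) * γ * q - 1) + (q : R) ^ 2 * γ := by ring
  rw [e]
  exact dvd_add (dvd_trans (⟨γ ^ 2, by ring⟩ : (q : R) ^ 2 ∣ ((q : R) * γ) ^ 2) h)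
    (dvd_mul_right _ _)

/-- First-order expansion of `∏ᵢ (1 - aᵢ x)^(nᵢ)`:
it is `1 - x Σᵢ nᵢ aᵢ` up to a multiple of `x²`. [folklore] -/
theorem exists_prod_one_sub_mul_pow_eq {R : Type*} [CommRing R] {ι : Type*} (s : Finset ι)
    (a : ι → R) (n : ι → ℕ) (x : R) :
    ∃ c : R, ∏ i ∈ s, (1 - a i * x) ^ n i = 1 - x * ∑ i ∈ s, (n i : R) * a i + x ^ 2 * c := by
  classical
  induction s using Finset.induction_on with
  | empty => exact ⟨0, by simp⟩
  | insert j s hj ih =>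
    obtain ⟨c, hc⟩ := ih
    -- one factor: `(1 - a x)^n = 1 - n a x + (a x)² c'`
    obtain ⟨c', hc'⟩ : ∃ c' : R, (1 - a j * x) ^ n j = 1 - (n j : R) * a j * x + x ^ 2 * c' := by
      obtain ⟨d, hd⟩ := sq_dvd_add_pow_sub_sub (-(a j * x)) 1 (n j)
      refine ⟨a j ^ 2 * d, ?_⟩
      simp only [one_pow, one_mul] at hd
      have : (1 + -(a j * x)) ^ n j = -(a j * x) * (n j) + 1 + (-(a j * x)) ^ 2 * d := by
        rw [← hd]; ring
      rw [← sub_eq_add_neg] at this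
      rw [this]; ring
    refine ⟨c' * (1 - x * ∑ i ∈ s, (n i : R) * a i + x ^ 2 * c) + c - (n j : R) * a j * c * x
      + (n j : R) * a j * (∑ i ∈ s, (n i : R) * a i), ?_⟩
    rw [prod_insert hj, sum_insert hj, hc, hc']
    ring

/-! ### Theorem I from Theorem 10.2 ([Schoof2009, p. 67–68]) -/

/-- [Schoof2009, Exercise 10.1] over `ℤ`, in the shape used for Theorem I: if `a ^ q ≡ -1`
modulo an odd prime `q` then `a ^ q ≡ -1 (mod q²)`. [cite: Schoof2009, Exercise 10.1] -/
theorem Int.sq_dvd_pow_add_one_of_dvd {q : ℕ} (hq : q.Prime) (hqo : Odd q) {a : ℤ}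
    (h : (q : ℤ) ∣ a ^ q + 1) : (q : ℤ) ^ 2 ∣ a ^ q + 1 := by
  -- `a ≡ a^q ≡ -1 (mod q)`
  have h1 : (q : ℤ) ∣ a + 1 := by
    haveI := Fact.mk hq
    have e : ((a ^ q + 1 : ℤ) : ZMod q) = ((a + 1 : ℤ) : ZMod q) := by
      push_cast
      rw [ZMod.pow_card]
    have h0 : ((a ^ q + 1 : ℤ) : ZMod q) = 0 := (ZMod.intCast_zmod_eq_zero_iff_dvd _ _).mpr h
    rw [e] at h0
    exact (ZMod.intCast_zmod_eq_zero_iff_dvd _ _).mp h0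
  obtain ⟨k, hk⟩ := h1
  have ha : a = -1 + q * k := by linarith
  obtain ⟨d, hd⟩ := sq_dvd_add_pow_sub_sub ((q : ℤ) * k) (-1) q
  have hq1 : (-1 : ℤ) ^ (q - 1) = 1 := by
    obtain ⟨m, hm⟩ := hqo
    rw [hm, Nat.add_sub_cancel, pow_mul]; norm_num
  rw [hqo.neg_one_pow, hq1, one_mul] at hd
  have : a ^ q + 1 = ((-1 + (q : ℤ) * k) ^ q - (q : ℤ) * k * q - -1) + (q : ℤ) ^ 2 * k := by
    rw [ha]; ring
  rw [this]
  exact dvd_add (dvd_trans (⟨k ^ 2, by ring⟩ : (q : ℤ) ^ 2 ∣ ((q : ℤ) * k) ^ 2) ⟨d, hd⟩)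
    (dvd_mul_right _ _)

/-- **Theorem I from Theorem 10.2** [Schoof2009, Chapter 10, proof of Theorem I, pp. 67–68].
Let `p, q` be odd primes and `x, y` non-zero integers with `x ^ p - y ^ q = 1`. If `q² ∣ x`
then `p ^ (q-1) ≡ 1 (mod q²)`: by Corollary 6.5, `x - 1 = p^(q-1) a^q`; reducing modulo `q`
(Cassels: `q ∣ x`; Fermat) gives `a^q ≡ -1 (mod q)`, hence `(mod q²)` (Exercise 10.1), and then
`-1 ≡ x - 1 ≡ -p^(q-1) (mod q²)`. [cite: Schoof2009, Theorem I (proof, Ch. 10 p. 68)] -/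
theorem isWieferich_of_sq_dvd {p q : ℕ} (hp : p.Prime) (hq : q.Prime) (hpo : Odd p) (hqo : Odd q)
    {x y : ℤ} (hx : x ≠ 0) (hy : y ≠ 0) (h : x ^ p - y ^ q = 1) (hq2 : (q : ℤ) ^ 2 ∣ x) :
    IsWieferich p q := by
  -- `p ≠ q` (Lemma 6.1)
  have hpq : p ≠ q := by
    rintro rfl
    have hp3 : 3 ≤ p := by
      have := hp.two_le
      obtain ⟨k, hk⟩ := hpo
      omega
    exact pow_sub_pow_ne_one hpo hp3 hx hy h
  obtain ⟨a, v, h1, -, -, -, -⟩ := cassels_padic hp hq hpo hqo hx hy h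
  have hqx : (q : ℤ) ∣ x := dvd_trans (dvd_pow_self _ two_ne_zero) hq2
  -- Fermat: `p^(q-1) ≡ 1 (mod q)`
  have hF : (q : ℤ) ∣ (p : ℤ) ^ (q - 1) - 1 := by
    have hcop : IsCoprime (p : ℤ) q := by
      rw [Int.isCoprime_iff_gcd_eq_one, Int.gcd_natCast_natCast]
      exact (Nat.coprime_primes hp hq).mpr hpq
    exact (Int.ModEq.pow_card_sub_one_eq_one hq hcop).symm.dvd
  -- `a^q ≡ -1 (mod q)`, hence `(mod q²)` (Exercise 10.1)
  have haq : (q : ℤ) ∣ a ^ q + 1 := by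
    have e : a ^ q + 1 = x - ((p : ℤ) ^ (q - 1) - 1) * a ^ q := by linear_combination (-1 : ℤ) * h1
    rw [e]
    exact dvd_sub hqx (dvd_mul_of_dvd_left hF _)
  have haq2 : (q : ℤ) ^ 2 ∣ a ^ q + 1 := Int.sq_dvd_pow_add_one_of_dvd hq hqo haq
  -- `p^(q-1) - 1 = p^(q-1) (a^q + 1) - x ≡ 0 (mod q²)`
  have hZ : (q : ℤ) ^ 2 ∣ (p : ℤ) ^ (q - 1) - 1 := by
    have e : (p : ℤ) ^ (q - 1) - 1 = (p : ℤ) ^ (q - 1) * (a ^ q + 1) - x := by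
      linear_combination h1
    rw [e]
    exact dvd_sub (dvd_mul_of_dvd_right haq2 _) hq2
  -- back to `ℕ`
  unfold IsWieferich
  have h1le : 1 ≤ p ^ (q - 1) := Nat.one_le_pow _ _ hp.pos
  refine ((Nat.modEq_iff_dvd' h1le).mpr ?_).symm
  have : ((p ^ (q - 1) - 1 : ℕ) : ℤ) = (p : ℤ) ^ (q - 1) - 1 := by push_cast [Nat.cast_sub h1le]; ring
  exact_mod_cast this ▸ hZ

/-! ### The ring `𝓞 K ⧸ (q)` of a `p`-th cyclotomic field for a prime `q ≠ p` -/

section Cyclotomic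

variable {p : ℕ} [hp : Fact p.Prime] {K : Type*} [Field K] [NumberField K]
  [IsCyclotomicExtension {p} ℚ K] {ζ : K} (hζ : IsPrimitiveRoot ζ p)

open Polynomial in
/-- [Schoof2009, Exercise 10.2] (the direction that is used): for a prime `q ≠ p` the ring
`ℤ[ζ_p]/(q)` has no non-zero nilpotent elements — it is `𝔽_q[X]/(Φ_p)` and `Φ_p` is separable
modulo `q`. [cite: Schoof2009, Exercise 10.2] -/
theorem isReduced_quotient_span_prime {q : ℕ} (hq : q.Prime) (hpq : p ≠ q) :
    IsReduced (𝓞 K ⧸ Ideal.span {(q : 𝓞 K)}) := by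
  classical
  have hζ := IsCyclotomicExtension.zeta_spec p ℚ K
  let pb := hζ.integralPowerBasis
  let I : Ideal ℤ := Ideal.span {(q : ℤ)}
  have hI : I.map (algebraMap ℤ (𝓞 K)) = Ideal.span {(q : 𝓞 K)} := by
    rw [Ideal.map_span, Set.image_singleton, map_natCast]
  have hqZ : Prime (q : ℤ) := Nat.prime_iff_prime_int.mp hq
  haveI hImax : I.IsMaximal :=
    (Ideal.span_singleton_prime hqZ.ne_zero |>.mpr hqZ).isMaximal (by
      rw [Ne, Ideal.span_singleton_eq_bot]; exact hqZ.ne_zero)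
  letI : Field (ℤ ⧸ I) := Ideal.Quotient.field I
  -- the reduction of the minimal polynomial of `ζ` modulo `q` is separable
  have hsep : (Polynomial.map (Ideal.Quotient.mk I) (minpoly ℤ pb.gen)).Separable := by
    have hgen : pb.gen = hζ.toInteger := hζ.integralPowerBasis_gen
    rw [hgen]
    have hdvd : Polynomial.map (Ideal.Quotient.mk I) (minpoly ℤ hζ.toInteger) ∣ X ^ p - C 1 := by
      have h1 := Polynomial.map_dvd (Ideal.Quotient.mk I)
        hζ.toInteger_isPrimitiveRoot.minpoly_dvd_x_pow_sub_one
      simpa [Polynomial.map_sub, Polynomial.map_pow] using h1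
    refine Separable.of_dvd (separable_X_pow_sub_C 1 ?_ one_ne_zero) hdvd
    intro h0
    have h0' : (Ideal.Quotient.mk I) (p : ℤ) = 0 := by rw [map_natCast]; exact h0
    rw [Ideal.Quotient.eq_zero_iff_mem, Ideal.mem_span_singleton, Int.natCast_dvd_natCast] at h0'
    exact hpq ((Nat.prime_dvd_prime_iff_eq hq hp.out).mp h0').symm
  have hrad : (Ideal.span {Polynomial.map (Ideal.Quotient.mk I) (minpoly ℤ pb.gen)}).IsRadical :=
    isRadical_iff_span_singleton.mp hsep.squarefree.isRadical
  haveI : IsReduced ((ℤ ⧸ I)[X] ⧸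
      Ideal.span {Polynomial.map (Ideal.Quotient.mk I) (minpoly ℤ pb.gen)}) :=
    (Ideal.isRadical_iff_quotient_reduced _).mp hrad
  have e := pb.quotientEquivQuotientMinpolyMap I
  have hred : IsReduced (𝓞 K ⧸ I.map (algebraMap ℤ (𝓞 K))) := isReduced_of_injective e e.injective
  rwa [hI] at hred

/-- [Schoof2009, Exercise 10.1] in `ℤ[ζ_p]` (with Exercise 10.2): for a prime `q ≠ p` and
`β ∈ ℤ[ζ_p]`, if `β ^ q ≡ 1 (mod q)` then `β ^ q ≡ 1 (mod q²)` — indeed `(β - 1)^q ≡ 0`, so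
`β ≡ 1 (mod q)` as `ℤ[ζ_p]/(q)` is reduced, and then the binomial theorem.
[cite: Schoof2009, Exercise 10.1] -/
theorem sq_dvd_pow_sub_one_of_dvd {q : ℕ} (hq : q.Prime) (hpq : p ≠ q) {β : 𝓞 K}
    (h : (q : 𝓞 K) ∣ β ^ q - 1) : (q : 𝓞 K) ^ 2 ∣ β ^ q - 1 := by
  haveI := isReduced_quotient_span_prime (K := K) hq hpq
  -- `(β - 1)^q ≡ β^q - 1 ≡ 0 (mod q)`
  obtain ⟨r, hr⟩ := exists_add_pow_prime_eq hq (β - 1) 1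
  rw [sub_add_cancel, one_pow] at hr
  have h1 : (q : 𝓞 K) ∣ (β - 1) ^ q := by
    have e : (β - 1) ^ q = (β ^ q - 1) - q * ((β - 1) * 1 * r) := by rw [hr]; ring
    rw [e]
    exact dvd_sub h (dvd_mul_right _ _)
  -- hence `β ≡ 1 (mod q)`
  have h2 : (q : 𝓞 K) ∣ β - 1 := by
    rw [← Ideal.mem_span_singleton, ← Ideal.Quotient.eq_zero_iff_mem]
    refine IsReduced.eq_zero _ ⟨q, ?_⟩
    rw [← map_pow, Ideal.Quotient.eq_zero_iff_mem, Ideal.mem_span_singleton]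
    exact h1
  obtain ⟨γ, hγ⟩ := h2
  rw [show β = 1 + q * γ by rw [← hγ]; ring]
  exact sq_dvd_one_add_mul_pow_sub_one q γ

/-- The conjugates `ζ, ζ², …, ζ^(p-1)` of `ζ_p` are `ℤ`-linearly independent modulo `q`:
if `q ∣ Σ_{1 ≤ i < p} nᵢ ζ^i` in `ℤ[ζ_p]` then `q ∣ nᵢ` for all `i` (they form a `ℤ`-basis of
`ℤ[ζ_p]`, being `ζ` times the power basis `1, ζ, …, ζ^(p-2)`). [cite: Schoof2009, Theorem 10.2 (proof, p. 68)] -/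
theorem dvd_coeff_of_dvd_sum_mul_zeta_pow {q : ℤ} {n : ℕ → ℤ}
    (h : (q : 𝓞 K) ∣ ∑ i ∈ Ico 1 p, (n i : 𝓞 K) * hζ.toInteger ^ i) :
    ∀ i ∈ Ico 1 p, q ∣ n i := by
  classical
  set z : 𝓞 K := hζ.toInteger with hz
  let pb := hζ.integralPowerBasis
  have hdim : pb.dim = p - 1 := by
    rw [hζ.integralPowerBasis_dim, Nat.totient_prime hp.out]
  have hzp : z ^ p = 1 := by
    have := hζ.toInteger_isPrimitiveRoot.pow_eq_one
    exact this
  -- multiply by `z^(p-1) = z⁻¹` and reindex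
  have hT : z ^ (p - 1) * ∑ i ∈ Ico 1 p, (n i : 𝓞 K) * z ^ i
      = ∑ j ∈ range (p - 1), (n (1 + j) : 𝓞 K) * z ^ j := by
    rw [mul_sum, sum_Ico_eq_sum_range]
    refine sum_congr rfl fun j hj => ?_
    have : z ^ (p - 1) * z ^ (1 + j) = z ^ j := by
      rw [← pow_add, show p - 1 + (1 + j) = p + j by have := hp.out.one_lt; omega, pow_add, hzp,
        one_mul]
    rw [← mul_assoc, mul_comm (z ^ (p - 1)), mul_assoc, this]
  obtain ⟨w, hw⟩ := h
  have hT' : ∑ j ∈ range (p - 1), (n (1 + j) : 𝓞 K) * z ^ j = (q : ℤ) • (w * z ^ (p - 1)) := by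
    rw [← hT, hw, zsmul_eq_mul]; ring
  -- read off coordinates in the integral power basis `1, z, …, z^(p-2)`
  have hsum : ∑ j ∈ range (p - 1), (n (1 + j) : 𝓞 K) * z ^ j
      = ∑ j : Fin pb.dim, (n (1 + j)) • pb.basis j := by
    rw [← hdim, ← Fin.sum_univ_eq_sum_range]
    refine Fintype.sum_congr _ _ fun j => ?_
    rw [pb.coe_basis, zsmul_eq_mul]
    simp [pb, hz]
  have hrepr := pb.basis.repr_sum_self fun j : Fin pb.dim => n (1 + j)
  rw [← hsum, hT', map_zsmul] at hrepr
  intro i hi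
  rw [mem_Ico] at hi
  have hj : i - 1 < pb.dim := by rw [hdim]; omega
  have := congrFun hrepr ⟨i - 1, hj⟩
  simp only [Finsupp.coe_smul, Pi.smul_apply, smul_eq_mul] at this
  rw [show 1 + (i - 1) = i by omega] at this
  exact ⟨_, this.symm⟩

/-- **The `q`-adic kernel of [Schoof2009, Theorem 10.2]** (p. 68). Let `p ≠ q` be primes
(`p` odd is not needed here), `ζ = ζ_p`, `x` an integer with `q ∣ x`, and suppose that
`∏_{1 ≤ i < p} (1 - ζ^i x)^(nᵢ) = β^q` for some `β ∈ ℤ[ζ_p]` and exponents `nᵢ ≥ 0` not all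
divisible by `q`. Then `q² ∣ x`. (In Schoof's proof the exponents are the coefficients of an
element `θ = Σ n_σ σ` of `(1 - ι)𝒮`, `𝒮` the Stickelberger ideal, and `β` comes from
Proposition 10.1; the argument below is the rest of that proof: `β^q ≡ 1 (mod q)` gives
`(mod q²)` by Exercises 10.1–10.2, so `x Σ nᵢ ζ^i ≡ 0 (mod q²)`, and the `ζ^i` are independent
modulo `q`.) [cite: Schoof2009, Theorem 10.2 (proof, p. 68)] -/
theorem sq_dvd_of_prod_one_sub_zeta_pow_mul_eq_pow {q : ℕ} (hq : q.Prime) (hpq : p ≠ q)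
    {x : ℤ} (hx : (q : ℤ) ∣ x) {n : ℕ → ℕ} {β : 𝓞 K}
    (h : ∏ i ∈ Ico 1 p, (1 - hζ.toInteger ^ i * x) ^ n i = β ^ q)
    (hn : ∃ i ∈ Ico 1 p, ¬ q ∣ n i) : (q : ℤ) ^ 2 ∣ x := by
  classical
  by_contra hx2
  obtain ⟨x₁, rfl⟩ := hx
  have hx₁ : ¬ (q : ℤ) ∣ x₁ := fun h' => hx2 (by rw [pow_two]; exact mul_dvd_mul_left _ h')
  set z : 𝓞 K := hζ.toInteger with hz
  set S : 𝓞 K := ∑ i ∈ Ico 1 p, (n i : 𝓞 K) * z ^ i with hS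
  obtain ⟨c, hc⟩ := exists_prod_one_sub_mul_pow_eq (Ico 1 p) (fun i => z ^ i) n
    (((q : ℤ) * x₁ : ℤ) : 𝓞 K)
  rw [h] at hc
  push_cast at hc
  have hq0 : (q : 𝓞 K) ≠ 0 := Nat.cast_ne_zero.mpr hq.ne_zero
  -- `β^q ≡ 1 (mod q)`, hence `(mod q²)`
  have h1 : (q : 𝓞 K) ∣ β ^ q - 1 := by
    rw [hc]
    exact ⟨-(x₁ * S) + q * x₁ ^ 2 * c, by rw [hS]; ring⟩
  have h2 := sq_dvd_pow_sub_one_of_dvd hq hpq h1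
  -- so `q² ∣ q x₁ S`, i.e. `q ∣ x₁ S`, i.e. `q ∣ S`
  have h3 : (q : 𝓞 K) ^ 2 ∣ q * (x₁ * S) := by
    have e : (q : 𝓞 K) * (x₁ * S) = (q : 𝓞 K) ^ 2 * (x₁ ^ 2 * c) - (β ^ q - 1) := by
      rw [hc, hS]; ring
    rw [e]
    exact dvd_sub (dvd_mul_right _ _) h2
  have h4 : (q : 𝓞 K) ∣ x₁ * S := by
    rw [pow_two] at h3
    exact (mul_dvd_mul_iff_left hq0).mp h3
  have hcop : IsCoprime (q : 𝓞 K) (x₁ : 𝓞 K) := by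
    have := ((Nat.prime_iff_prime_int.mp hq).coprime_iff_not_dvd.mpr hx₁).map
      (Int.castRingHom (𝓞 K))
    simpa using this
  have h5 : (q : 𝓞 K) ∣ S := hcop.dvd_of_dvd_mul_left h4
  -- independence of the `ζ^i` modulo `q`
  have h6 := dvd_coeff_of_dvd_sum_mul_zeta_pow hζ (q := q) (n := fun i => (n i : ℤ))
    (by simpa [hS] using h5)
  obtain ⟨i, hi, hni⟩ := hn
  exact hni (Int.natCast_dvd_natCast.mp (h6 i hi))

/-- **Mihăilescu's Theorem I for `(p, q)` from the Stickelberger output alone**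
([Schoof2009, Theorem 10.2 and Theorem I]). Let `p, q` be odd primes and `x, y` non-zero
integers with `x ^ p - y ^ q = 1`. If in some `p`-th cyclotomic field one has
`∏_{1 ≤ i < p} (1 - ζ_p^i x)^(nᵢ) = β^q` with `β` integral and some `nᵢ ≢ 0 (mod q)` — which is
what [Schoof2009, Proposition 10.1] (Stickelberger's theorem) supplies for `θ ∈ (1 - ι)𝒮` —
then `q² ∣ x` (Theorem 10.2; Cassels gives `q ∣ x`) and `p ^ (q-1) ≡ 1 (mod q²)` (Theorem I).
[cite: Schoof2009, Theorem I (Ch. 10, pp. 67–68)] -/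
theorem isWieferich_of_prod_one_sub_zeta_pow_mul_eq_pow {q : ℕ} (hq : q.Prime) (hpo : Odd p)
    (hqo : Odd q) {x y : ℤ} (hx : x ≠ 0) (hy : y ≠ 0) (h : x ^ p - y ^ q = 1) {n : ℕ → ℕ}
    {β : 𝓞 K} (hβ : ∏ i ∈ Ico 1 p, (1 - hζ.toInteger ^ i * x) ^ n i = β ^ q)
    (hn : ∃ i ∈ Ico 1 p, ¬ q ∣ n i) : (q : ℤ) ^ 2 ∣ x ∧ IsWieferich p q := by
  have hpq : p ≠ q := by
    rintro rfl
    have hp3 : 3 ≤ p := by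
      have := hp.out.two_le
      obtain ⟨k, hk⟩ := hpo
      omega
    exact pow_sub_pow_ne_one hpo hp3 hx hy h
  obtain ⟨hqx, -⟩ := cassels hp.out hq hpo hqo hx hy h
  have hq2 := sq_dvd_of_prod_one_sub_zeta_pow_mul_eq_pow hζ hq hpq hqx hβ hn
  exact ⟨hq2, isWieferich_of_sq_dvd hp.out hq hpo hqo hx hy h hq2⟩

end Cyclotomic

end Catalan

end Literature.NumberTheory.DiophantineGeometry
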